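import Literature.Computability.Cryptography.InfrastructureWalkFP
import HarnessLib

/-!
# A `GiantStepCycle` from a filtered chain walked by integer operations

Topic `Computability/Cryptography`; sequel of `InfrastructureNavigation.lean` (`GiantStepCycle`) and
`InfrastructureWalkFP.lean` (`IntWalkOps`). The ABSTRACT half of "the programs of a unit-rank-one
infrastructure carry a `GiantStepCycle`" (Buchmann–Williams 1988 walk, Jozsa 2003 §7, §9 axioms):

* `iterate_flag_eq` — the loop `s ↦ if s.2 then s else (G s.1, p (G s.1))`, iterated `N` times
  from `(y, p y)`, stops at `(G^[k] y, true)` where `k ≤ N` is the first time the flag `p` holds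
  (the shape of the filtered baby step / giant step / start-up loops of the cubic walk);
* `apply_add_mul_period`, `apply_add_int_mul_period` — iterating a one-step period
  `f (i + c) = f i + e` to integer multiples;
* **`GiantStepCycle.exists_of_chain`** — given integer walk operations `O` at instance `d`, true
  log-distances `ℓ : ℤ → ℝ` along a two-sided chain (strictly increasing, `ℓ (i + n₀) = ℓ i + R`),
  the increasing enumeration `s` of the filtered indices (`s (i + nS) = s i + n₀`), labels
  `lab : ℤ → ι` of the filtered points repeating exactly with period `nS`, and the WALK FACTS
  (`unit = lab 0`, `rho (lab i) = lab (i+1)` with `gInt` within `16` of `2ᵖ ×` the gap, the giant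
  step `star (lab i₁) (lab i₂) = lab i` with the raw defect evaluator within `16` of `2ᵖ ×` the true
  defect `ℓ(s i) − ℓ(s i₁) − ℓ(s i₂) + ℓ(s 0)` and that defect at most `(KInt − 2ᵖ)/2ᵖ`, `kInt` the
  raw evaluator CLAMPED to `[−KInt, KInt]`), filtered gaps in `[log (11/10), G]` and `p ≥ 9`: there is
  a `GiantStepCycle` whose `WalkData` is LITERALLY `O.toWalkData d`, with `L = log (11/10)`,
  `η = 16/2ᵖ`, circumference `R`, `n = nS` points, distances `P m = ℓ (s m) − ℓ (s 0)` and labels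
  `lab`. The defect `kappa` is the true defect on pairs of labels of the cycle and the computed one
  elsewhere, so that the two global axioms (`|kappa| ≤ K`, `|khat − kappa| ≤ η`) hold off the cycle by
  the clamp and on the cycle because the clamp does not bite.

Theorem-only file; no number theory here (the cubic instance supplies `ℓ, s, lab` from Voronoi's
chain of relative minima).

## References

* R. Jozsa, *Notes on Hallgren's efficient quantum algorithm for solving Pell's equation*,
  arXiv:quant-ph/0302134 (2003), §7 Props. 31–33, §9 Thm. 5. [Jozsa2003]
* J. Buchmann, H. C. Williams, *On the infrastructure of the principal ideal class of an algebraic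
  number field of unit rank one*, Math. Comp. 50 (1988), §3. [BuchmannWilliams1988Infrastructure]
-/

namespace Literature.Computability.Cryptography

open WalkData

/-! ### The flagged loop -/

/-- **The flagged loop stops at the first flag.** For `F s = if s.2 then s else (G s.1, p (G s.1))`:
if `p (G^[t] y) = false` for `t < k` and `p (G^[k] y) = true` with `k ≤ N`, then
`F^[N] (y, p y) = (G^[k] y, true)`. [folklore] -/
theorem iterate_flag_eq {α : Type*} (G : α → α) (p : α → Bool) :
    ∀ (k N : ℕ) (y : α), k ≤ N → (∀ t, t < k → p (G^[t] y) = false) → p (G^[k] y) = true →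
      (fun s : α × Bool => if s.2 = true then s else (G s.1, p (G s.1)))^[N] (y, p y) = (G^[k] y, true) := by
  intro k
  induction k with
  | zero =>
    intro N y _ _ hk
    simp only [Function.iterate_zero, id_eq] at hk
    rw [hk]
    induction N with
    | zero => rfl
    | succ N ih =>
      rw [Function.iterate_succ_apply]
      simp only [if_true]
      exact ih (Nat.zero_le _)
  | succ k ih =>
    intro N y hkN hlt hk
    obtain ⟨N, rfl⟩ : ∃ N', N = N' + 1 := ⟨N - 1, by omega⟩
    have h0 : p y = false := by simpa using hlt 0 (Nat.succ_pos k)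
    rw [Function.iterate_succ_apply, h0]
    simp only [Bool.false_eq_true, if_false]
    have h := ih N (G y) (by omega) (fun t ht => by
      rw [← Function.iterate_succ_apply]; exact hlt (t + 1) (by omega))
      (by rw [← Function.iterate_succ_apply]; exact hk)
    rw [h, Function.iterate_succ_apply]

/-- The flagged loop from an already flagged state does nothing. [folklore] -/
theorem iterate_flag_true {α : Type*} (G : α → α) (p : α → Bool) (N : ℕ) (y : α) :
    (fun s : α × Bool => if s.2 = true then s else (G s.1, p (G s.1)))^[N] (y, true) = (y, true) := by
  induction N with
  | zero => rfl
  | succ N ih => rw [Function.iterate_succ_apply]; simpa using ih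

/-! ### Periods -/

/-- Iterating a one-step period over `ℕ`: `f (i + k c) = f i + k e`. [folklore] -/
theorem apply_add_mul_period {β : Type*} [AddCommGroup β] {f : ℤ → β} {c : ℤ} {e : β}
    (h : ∀ i, f (i + c) = f i + e) (i : ℤ) (k : ℕ) : f (i + k * c) = f i + k • e := by
  induction k with
  | zero => simp
  | succ k ih =>
    rw [show i + ((k + 1 : ℕ) : ℤ) * c = (i + k * c) + c by push_cast; ring, h, ih, succ_nsmul, add_assoc]

/-- Iterating a one-step period over `ℤ`: `f (i + k c) = f i + k e`. [folklore] -/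
theorem apply_add_int_mul_period {β : Type*} [AddCommGroup β] {f : ℤ → β} {c : ℤ} {e : β}
    (h : ∀ i, f (i + c) = f i + e) (i k : ℤ) : f (i + k * c) = f i + k • e := by
  obtain ⟨n, rfl | rfl⟩ := Int.eq_nat_or_neg k
  · rw [apply_add_mul_period h, natCast_zsmul]
  · have h' := apply_add_mul_period h (i + -(n : ℤ) * c) n
    rw [show i + -(n : ℤ) * c + n * c = i by ring] at h'
    rw [neg_zsmul, natCast_zsmul, eq_sub_iff_add_eq.mpr h'.symm, sub_eq_add_neg]

/-! ### The cycle carried by the walk operations -/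

/-- **A `GiantStepCycle` from a filtered chain walked by integer operations** (see the module
docstring for the list of walk facts). The `WalkData` of the cycle is literally `O.toWalkData d`;
`L = log (11/10)`, `η = 16/2ᵖ`, circumference `R`, `n = nS`, `P m = ℓ (s m) − ℓ (s 0)`, labels `lab`.
[cite: Jozsa2003, §7 Props. 31–33, §9 Thm. 5] -/
theorem GiantStepCycle.exists_of_chain {δ ι : Type} (O : IntWalkOps δ ι) (d : δ)
    (ℓ : ℤ → ℝ) (s : ℤ → ℤ) (n₀ nS : ℕ) (R Gb : ℝ) (lab : ℤ → ι) (kraw : ι → ι → ℤ)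
    (hℓ : StrictMono ℓ) (hper : ∀ i, ℓ (i + n₀) = ℓ i + R)
    (hs : StrictMono s) (hnS : 0 < nS) (hsper : ∀ i, s (i + nS) = s i + n₀)
    (hlab : ∀ i j, lab i = lab j ↔ (nS : ℤ) ∣ i - j)
    (hunit : O.unit d = lab 0)
    (hrho : ∀ i, O.rho d (lab i) = lab (i + 1))
    (hg : ∀ i, |(O.gInt d (lab i) : ℝ) - 2 ^ O.prec d * (ℓ (s (i + 1)) - ℓ (s i))| ≤ 16)
    (hkInt : ∀ c₁ c₂, O.kInt d c₁ c₂ = max (-(O.KInt d : ℤ)) (min (O.KInt d : ℤ) (kraw c₁ c₂)))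
    (hstar : ∀ i₁ i₂, ∃ i, O.star d (lab i₁) (lab i₂) = lab i ∧
       |(kraw (lab i₁) (lab i₂) : ℝ) - 2 ^ O.prec d * (ℓ (s i) - ℓ (s i₁) - ℓ (s i₂) + ℓ (s 0))| ≤ 16 ∧
       2 ^ O.prec d * |ℓ (s i) - ℓ (s i₁) - ℓ (s i₂) + ℓ (s 0)| + 2 ^ O.prec d ≤ O.KInt d)
    (hgapL : ∀ i, Real.log (11 / 10) ≤ ℓ (s (i + 1)) - ℓ (s i))
    (hgapG : ∀ i, ℓ (s (i + 1)) - ℓ (s i) ≤ Gb)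
    (hprec : 9 ≤ O.prec d) :
    ∃ C : GiantStepCycle ι, C.toWalkData = O.toWalkData d ∧ C.L = Real.log (11 / 10) ∧
      C.η = 16 / 2 ^ O.prec d ∧ C.G = Gb ∧ C.R = R ∧ C.n = nS ∧ (∀ m, C.lab m = lab m) ∧
      (∀ m, C.P m = ℓ (s m) - ℓ (s 0)) := by
  classical
  -- the landing index of the giant step and the true defect
  obtain ⟨pick, hpick⟩ : ∃ pick : ℤ → ℤ → ℤ, ∀ i₁ i₂, O.star d (lab i₁) (lab i₂) = lab (pick i₁ i₂) ∧
      |(kraw (lab i₁) (lab i₂) : ℝ) - 2 ^ O.prec d * (ℓ (s (pick i₁ i₂)) - ℓ (s i₁) - ℓ (s i₂) + ℓ (s 0))| ≤ 16 ∧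
      2 ^ O.prec d * |ℓ (s (pick i₁ i₂)) - ℓ (s i₁) - ℓ (s i₂) + ℓ (s 0)| + 2 ^ O.prec d ≤ O.KInt d :=
    ⟨fun i₁ i₂ => (hstar i₁ i₂).choose, fun i₁ i₂ => (hstar i₁ i₂).choose_spec⟩
  set κ : ℤ → ℤ → ℝ := fun i₁ i₂ => ℓ (s (pick i₁ i₂)) - ℓ (s i₁) - ℓ (s i₂) + ℓ (s 0) with hκ
  set W : WalkData ι := O.toWalkData d with hW
  -- the defect: true on the cycle, computed off the cycle
  obtain ⟨kap, hkap_on, hkap_off⟩ : ∃ kap : ι → ι → ℝ,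
      (∀ c₁ c₂, (∃ i₁ i₂, c₁ = lab i₁ ∧ c₂ = lab i₂) → ∃ i₁ i₂, c₁ = lab i₁ ∧ c₂ = lab i₂ ∧ kap c₁ c₂ = κ i₁ i₂) ∧
      (∀ c₁ c₂, ¬ (∃ i₁ i₂, c₁ = lab i₁ ∧ c₂ = lab i₂) → kap c₁ c₂ = (W.khat c₁ c₂ : ℝ)) := by
    refine ⟨fun c₁ c₂ => if h : ∃ i₁ i₂, c₁ = lab i₁ ∧ c₂ = lab i₂ then κ h.choose h.choose_spec.choose
      else (W.khat c₁ c₂ : ℝ), fun c₁ c₂ h => ?_, fun c₁ c₂ h => by simp only [dif_neg h]⟩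
    refine ⟨h.choose, h.choose_spec.choose, h.choose_spec.choose_spec.1, h.choose_spec.choose_spec.2, ?_⟩
    simp only [dif_pos h]
  -- numerics
  have h2p : (0 : ℝ) < 2 ^ O.prec d := by positivity
  have h512 : (512 : ℝ) ≤ 2 ^ O.prec d := by
    calc (512 : ℝ) = 2 ^ 9 := by norm_num
      _ ≤ 2 ^ O.prec d := pow_le_pow_right₀ (by norm_num) hprec
  have hL : (1 : ℝ) / 11 ≤ Real.log (11 / 10) := by
    have h := Real.one_sub_inv_le_log_of_pos (show (0 : ℝ) < 11 / 10 by norm_num)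
    norm_num at h ⊢
    linarith
  -- periods
  have hsq : ∀ i (q : ℤ), s (i + q * nS) = s i + q * n₀ := fun i q => by
    have h := apply_add_int_mul_period hsper i q
    rwa [smul_eq_mul] at h
  have hℓq : ∀ j (q : ℤ), ℓ (j + q * n₀) = ℓ j + q * R := fun j q => by
    have h := apply_add_int_mul_period hper j q
    rwa [zsmul_eq_mul] at h
  have hPper : ∀ i (q : ℤ), ℓ (s (i + q * nS)) = ℓ (s i) + q * R := fun i q => by
    rw [hsq, hℓq]
  -- fields of `W` unfolded
  have hWghat : ∀ c, (W.ghat c : ℝ) = (O.gInt d c : ℝ) / 2 ^ O.prec d := fun c => by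
    simp [hW, IntWalkOps.toWalkData]
  have hWkhat : ∀ c₁ c₂, (W.khat c₁ c₂ : ℝ) = (O.kInt d c₁ c₂ : ℝ) / 2 ^ O.prec d := fun c₁ c₂ => by
    simp [hW, IntWalkOps.toWalkData]
  have hWK : ((W.K : ℚ) : ℝ) = (O.KInt d : ℝ) / 2 ^ O.prec d := by simp [hW, IntWalkOps.toWalkData]
  have hclamp : ∀ c₁ c₂, |(O.kInt d c₁ c₂ : ℝ)| ≤ O.KInt d := fun c₁ c₂ => by
    rw [hkInt]
    have h1 : -(O.KInt d : ℤ) ≤ max (-(O.KInt d : ℤ)) (min (O.KInt d : ℤ) (kraw c₁ c₂)) := le_max_left _ _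
    have h2 : max (-(O.KInt d : ℤ)) (min (O.KInt d : ℤ) (kraw c₁ c₂)) ≤ (O.KInt d : ℤ) :=
      max_le (by omega) (min_le_left _ _)
    rw [abs_le]
    constructor
    · exact_mod_cast h1
    · exact_mod_cast h2
  -- on the cycle the clamp does not bite
  have hbite : ∀ i₁ i₂, O.kInt d (lab i₁) (lab i₂) = kraw (lab i₁) (lab i₂) := fun i₁ i₂ => by
    obtain ⟨-, hk1, hk2⟩ := hpick i₁ i₂
    have h16 : (16 : ℝ) ≤ 2 ^ O.prec d := by linarith
    have hab : |(kraw (lab i₁) (lab i₂) : ℝ)| ≤ O.KInt d := by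
      have := abs_sub_abs_le_abs_sub (kraw (lab i₁) (lab i₂) : ℝ) (2 ^ O.prec d * κ i₁ i₂)
      rw [abs_mul, abs_of_pos h2p] at this
      linarith
    have hab' : |kraw (lab i₁) (lab i₂)| ≤ (O.KInt d : ℤ) := by exact_mod_cast hab
    rw [abs_le] at hab'
    rw [hkInt, min_eq_right hab'.2, max_eq_right hab'.1]
  -- fields: toWalkData R n P lab kappa η G L n_pos strictMono P_zero lab_zero periodic lab_eq_iff rho_lab
  --   star_lab abs_kappa_le ghat_spec khat_spec η_nonneg η_le gap_le two_gap L_gt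
  refine ⟨⟨W, R, nS, fun m => ℓ (s m) - ℓ (s 0), lab, kap, 16 / 2 ^ O.prec d, Gb, Real.log (11 / 10), hnS,
      fun m m' h => sub_lt_sub_right (hℓ (hs h)) _, sub_self _, hunit.symm, fun m => ?_, hlab, hrho,
      fun m₁ m₂ => ?_, fun c₁ c₂ => ?_, fun m => ?_, fun c₁ c₂ => ?_, by positivity, ?_,
      fun m => by have h := hgapG m; linarith, fun m => ?_, ?_⟩,
    rfl, rfl, rfl, rfl, rfl, rfl, fun m => rfl, fun m => rfl⟩
  · -- periodic
    show ℓ (s (m + nS)) - ℓ (s 0) = ℓ (s m) - ℓ (s 0) + R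
    rw [hsper, hper]; ring
  · -- star_lab
    obtain ⟨i₁, i₂, h₁, h₂, hk⟩ := hkap_on (lab m₁) (lab m₂) ⟨m₁, m₂, rfl, rfl⟩
    obtain ⟨q₁, hq₁⟩ := (hlab m₁ i₁).mp h₁
    obtain ⟨q₂, hq₂⟩ := (hlab m₂ i₂).mp h₂
    refine ⟨pick i₁ i₂ + (q₁ + q₂) * nS, ?_, ?_⟩
    · show lab (pick i₁ i₂ + (q₁ + q₂) * nS) = O.star d (lab m₁) (lab m₂)
      rw [h₁, h₂, (hpick i₁ i₂).1, hlab]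
      exact ⟨q₁ + q₂, by ring⟩
    · show ℓ (s (pick i₁ i₂ + (q₁ + q₂) * nS)) - ℓ (s 0) =
        ℓ (s m₁) - ℓ (s 0) + (ℓ (s m₂) - ℓ (s 0)) + kap (lab m₁) (lab m₂)
      rw [hk, hPper, show m₁ = i₁ + q₁ * nS by rw [mul_comm]; omega, show m₂ = i₂ + q₂ * nS by rw [mul_comm]; omega,
        hPper, hPper, hκ]
      push_cast
      ring
  · -- abs_kappa_le
    show |kap c₁ c₂| ≤ ((W.K : ℚ) : ℝ)
    rw [hWK]
    by_cases h : ∃ i₁ i₂, c₁ = lab i₁ ∧ c₂ = lab i₂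
    · obtain ⟨i₁, i₂, rfl, rfl, hk⟩ := hkap_on c₁ c₂ h
      rw [hk, le_div_iff₀ h2p]
      obtain ⟨-, -, hk2⟩ := hpick i₁ i₂
      rw [hκ]; nlinarith [abs_nonneg (ℓ (s (pick i₁ i₂)) - ℓ (s i₁) - ℓ (s i₂) + ℓ (s 0))]
    · rw [hkap_off c₁ c₂ h, hWkhat, abs_div, abs_of_pos h2p]
      exact div_le_div_of_nonneg_right (hclamp c₁ c₂) h2p.le
  · -- ghat_spec
    show |(W.ghat (lab m) : ℝ) - (ℓ (s (m + 1)) - ℓ (s 0) - (ℓ (s m) - ℓ (s 0)))| ≤ 16 / 2 ^ O.prec d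
    rw [hWghat, le_div_iff₀ h2p, ← abs_of_pos h2p, ← abs_mul, abs_of_pos h2p]
    have := hg m
    rw [show ((O.gInt d (lab m) : ℝ) / 2 ^ O.prec d - (ℓ (s (m + 1)) - ℓ (s 0) - (ℓ (s m) - ℓ (s 0)))) * 2 ^ O.prec d =
      (O.gInt d (lab m) : ℝ) - 2 ^ O.prec d * (ℓ (s (m + 1)) - ℓ (s m)) by field_simp; ring]
    exact this
  · -- khat_spec
    show |(W.khat c₁ c₂ : ℝ) - kap c₁ c₂| ≤ 16 / 2 ^ O.prec d
    by_cases h : ∃ i₁ i₂, c₁ = lab i₁ ∧ c₂ = lab i₂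
    · obtain ⟨i₁, i₂, rfl, rfl, hk⟩ := hkap_on c₁ c₂ h
      rw [hk, hWkhat, hbite, le_div_iff₀ h2p, ← abs_of_pos h2p, ← abs_mul, abs_of_pos h2p]
      obtain ⟨-, hk1, -⟩ := hpick i₁ i₂
      rw [show ((kraw (lab i₁) (lab i₂) : ℝ) / 2 ^ O.prec d - κ i₁ i₂) * 2 ^ O.prec d =
        (kraw (lab i₁) (lab i₂) : ℝ) - 2 ^ O.prec d * κ i₁ i₂ by field_simp]
      exact hk1
    · rw [hkap_off c₁ c₂ h, sub_self, abs_zero]; positivity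
  · -- η_le
    show (16 : ℝ) / 2 ^ O.prec d ≤ 1 / 8
    rw [div_le_div_iff₀ h2p (by norm_num)]; linarith
  · -- two_gap
    show Real.log (11 / 10) ≤ ℓ (s (m + 2)) - ℓ (s 0) - (ℓ (s m) - ℓ (s 0))
    have h1 := hgapL m
    have h2 := hgapL (m + 1)
    rw [show m + 1 + 1 = m + 2 by ring] at h2
    linarith
  · -- L_gt
    show 2 * ((16 : ℝ) / 2 ^ O.prec d) < Real.log (11 / 10)
    calc 2 * ((16 : ℝ) / 2 ^ O.prec d) ≤ 2 * (16 / 512) := by gcongr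
      _ < 1 / 11 := by norm_num
      _ ≤ _ := hL

end Literature.Computability.Cryptography
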